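import Summits.Ventures.PercRepro.RankLevelSetRuleQSwap
import Summits.Ventures.PercRepro.RankLevelSetRuleQCount

/-!
# PercRepro — RULE Q AT THE TIGHT LAYER OF EVERY CELL REDUCES TO THE BINOMIAL INEQUALITY (R̂) (night-1, gen 13; dossier §23.8)

The matroid half of the reduction, assembled in the kernel: for a member `Z` of the cell `(q + k, q)` at the tight layer
`#E = (q+k) + q`, with `P = flatPart M Z`, `D = freePart M Z`:
* `memCount_le_mhat` — the members inside `Z ∪ X_P ∪ X_D` (`X_P ⊆ P`, `X_D ⊆ D`) number at most `m̂(q, #P; #X_P, #X_D)`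
  (the swap count of RankLevelSetRuleQCount with the co-independence bound `#(Z′ ∩ D) ≤ q − #P` of RankLevelSetRuleQSwap);
* `rhat` — `R̂(q,k,m) = Σ_{0<j<k} Σ_{a≤m} C(m,a)·C(q+k−m,j) / m̂(q,m;a,j)`; `RhatIneq` — the `Prop` (NOT asserted):
  `Φ(q+k,q) ≤ R̂(q,k,m)` for all `q ≥ 1`, `k ≥ 2`, `m ≤ q` (item C-044-(R̂); exact for `q ≤ 60`, `k ≤ 12`, all `m`);
* **`rhat_le_ruleQRecv`** — `R̂(q,k,#P) ≤ recv(Z)`: the index sets `Z ∪ X_P ∪ X_D` (`∅ ≠ X_D`, `#X_D < k`) are distinct sets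
  of `Y` above `Z`, there are `C(#P,a)·C(#D,j)` of them with sizes `(a,j)`, each worth at least `1/m̂`;
* `ncard_flatPart_le` — `#P ≤ q`;
* **`ruleQUp_of_ncard_eq_of_rhat`** — `RhatIneq → RuleQUp M (q+k) q` at the tight layer;
* **`hallUp_of_ncard_eq_of_rhat`** — `RhatIneq` ⇒ the UP-Hall condition of C-044 at the tight layer of every cell
  (via `hallUp_of_ruleQ`).  With `hallDown_of_ncard_eq` this is C-044 at the tight layer in both forms, modulo (R̂).
Axioms: standard.
-/

namespace PercRepro

open Set Matroid Finset

variable {α : Type} (M : Matroid α) [M.Finite]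
/-- **The swap count at the tight layer**: `memCount M p q (Z ∪ X_P ∪ X_D) ≤ mhat q #P #X_P #X_D`. -/
theorem memCount_le_mhat {p q : ℕ} (hE : M.E.ncard = p + q) {Z : Set α} (hZ : Z ∈ cellMembers M p q)
    {XP XD : Set α} (hXP : XP ⊆ flatPart M Z) (hXD : XD ⊆ freePart M Z) :
    memCount M p q (Z ∪ XP ∪ XD) ≤ mhat q (flatPart M Z).ncard XP.ncard XD.ncard := by
  unfold mhat
  refine memCount_le_swapSum M hE hZ hXP hXD (q - (flatPart M Z).ncard) ?_
  intro Z' hZ'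
  have h1 : (Z' ∩ XD).ncard ≤ (Z' ∩ freePart M Z).ncard :=
    ncard_le_ncard (inter_subset_inter_right _ hXD)
      ((M.ground_finite.subset (fun x hx => hx.1.1)).subset inter_subset_right)
  have h2 := ncard_inter_freePart_add_ncard_flatPart_le M hE hZ hZ'
  omega

/-- `R̂(q, k, m)`: the lower bound on `recv(Z)` of dossier §23.8 (D), as a rational. -/
def rhat (q k m : ℕ) : ℚ :=
  ∑ j ∈ Finset.Ioo 0 k, ∑ a ∈ Finset.range (m + 1),
    ((m.choose a * (q + k - m).choose j : ℕ) : ℚ) / (mhat q m a j : ℚ)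

/-- **The arithmetic inequality (R̂)** (item C-044-(R̂); a `Prop`, NOT asserted): `Φ(q+k, q) ≤ R̂(q, k, m)` for all
`q ≥ 1`, `k ≥ 2`, `0 ≤ m ≤ q`. -/
def RhatIneq : Prop := ∀ q k m : ℕ, 1 ≤ q → 2 ≤ k → m ≤ q → phiK (q + k) q ≤ rhat q k m

/-- `Z` is a member inside any `S ⊇ Z`, so `memCount` is positive there. -/
lemma one_le_memCount_of_subset {p q : ℕ} {Z S : Set α} (hZ : Z ∈ cellMembers M p q) (hZS : Z ⊆ S) :
    1 ≤ memCount M p q S := by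
  unfold memCount
  have hfin : {Z' : Set α | Z' ∈ cellMembers M p q ∧ Z' ⊆ S}.Finite :=
    (cellMembers_finite M p q).subset (fun _ h => h.1)
  have : Z ∈ {Z' : Set α | Z' ∈ cellMembers M p q ∧ Z' ⊆ S} := ⟨hZ, hZS⟩
  exact Nat.one_le_iff_ne_zero.2 (ncard_ne_zero_of_mem this hfin)

/-- **`recv(Z) ≥ R̂(q, k, #P)`** for every member `Z` at the tight layer of the cell `(q + k, q)`: the index sets
`Z ∪ X_P ∪ X_D` (`X_P ⊆ P`, `∅ ≠ X_D ⊆ D`, `#X_D ≤ k − 1`) are distinct sets of `Y` above `Z`, each receiving at least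
`1 / m̂(q, #P; #X_P, #X_D)`, and there are `C(#P, a)·C(#D, j)` of them with sizes `(a, j)`. -/
theorem rhat_le_ruleQRecv {q k : ℕ} (hE : M.E.ncard = (q + k) + q) {Z : Set α}
    (hZ : Z ∈ cellMembers M (q + k) q) :
    rhat q k (flatPart M Z).ncard ≤ ruleQRecv M (q + k) q Z := by
  classical
  set p := q + k with hp
  have hPfin : (flatPart M Z).Finite := M.ground_finite.subset (fun x hx => hx.1.1)
  have hDfin : (freePart M Z).Finite := M.ground_finite.subset (fun x hx => hx.1.1)
  set Pf := hPfin.toFinset with hPf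
  set Df := hDfin.toFinset with hDf
  set m := (flatPart M Z).ncard with hm
  have hPcard : Pf.card = m := by rw [hPf, hm, ncard_eq_toFinset_card _ hPfin]
  have hDcard : Df.card = q + k - m := by
    rw [hDf, ← ncard_eq_toFinset_card _ hDfin]
    have := ncard_freePart_add_ncard_flatPart M hE hZ
    omega
  -- the pairs (X_P, X_D) and the map to the index sets
  set Pairs : Finset (Finset α × Finset α) :=
    Pf.powerset ×ˢ (Df.powerset.filter (fun XD => 0 < XD.card ∧ XD.card < k)) with hPairs
  set g : Finset α × Finset α → Set α := fun t => Z ∪ (↑t.1 : Set α) ∪ (↑t.2 : Set α) with hg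
  -- disjointness of Z, P, D
  have hZP : Disjoint Z (flatPart M Z) := Set.disjoint_left.2 (fun x hx hx' => hx'.1.2 hx)
  have hZD : Disjoint Z (freePart M Z) := Set.disjoint_left.2 (fun x hx hx' => hx'.1.2 hx)
  have hPD : Disjoint (flatPart M Z) (freePart M Z) := Set.disjoint_left.2 (fun x hx hx' => hx'.2 hx.2)
  have hmemPairs : ∀ t ∈ Pairs, (↑t.1 : Set α) ⊆ flatPart M Z ∧ (↑t.2 : Set α) ⊆ freePart M Z ∧
      0 < t.2.card ∧ t.2.card < k := by
    intro t ht
    rw [hPairs, Finset.mem_product, Finset.mem_powerset, Finset.mem_filter, Finset.mem_powerset] at ht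
    refine ⟨?_, ?_, ht.2.2.1, ht.2.2.2⟩
    · intro x hx
      have := ht.1 hx
      rw [hPf, hPfin.mem_toFinset] at this
      exact this
    · intro x hx
      have := ht.2.1 hx
      rw [hDf, hDfin.mem_toFinset] at this
      exact this
  -- injectivity of g on Pairs: X_P = g t ∩ P, X_D = g t ∩ D
  have hginj : Set.InjOn g Pairs := by
    intro t₁ ht₁ t₂ ht₂ hEq
    obtain ⟨hP₁, hD₁, -, -⟩ := hmemPairs t₁ (Finset.mem_coe.1 ht₁)
    obtain ⟨hP₂, hD₂, -, -⟩ := hmemPairs t₂ (Finset.mem_coe.1 ht₂)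
    simp only [hg] at hEq
    have e1 : (↑t₁.1 : Set α) = ↑t₂.1 := by
      have h : (Z ∪ (↑t₁.1 : Set α) ∪ ↑t₁.2) ∩ flatPart M Z = (Z ∪ (↑t₂.1 : Set α) ∪ ↑t₂.2) ∩ flatPart M Z := by
        rw [hEq]
      rw [Set.union_inter_distrib_right, Set.union_inter_distrib_right, hZP.inter_eq,
        Set.inter_eq_left.2 hP₁, (hPD.symm.mono_left hD₁).inter_eq, Set.union_inter_distrib_right,
        Set.union_inter_distrib_right, hZP.inter_eq, Set.inter_eq_left.2 hP₂,
        (hPD.symm.mono_left hD₂).inter_eq] at h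
      simpa using h
    have e2 : (↑t₁.2 : Set α) = ↑t₂.2 := by
      have h : (Z ∪ (↑t₁.1 : Set α) ∪ ↑t₁.2) ∩ freePart M Z = (Z ∪ (↑t₂.1 : Set α) ∪ ↑t₂.2) ∩ freePart M Z := by
        rw [hEq]
      rw [Set.union_inter_distrib_right, Set.union_inter_distrib_right, hZD.inter_eq,
        (hPD.mono_left hP₁).inter_eq, Set.inter_eq_left.2 hD₁, Set.union_inter_distrib_right,
        Set.union_inter_distrib_right, hZD.inter_eq, (hPD.mono_left hP₂).inter_eq,
        Set.inter_eq_left.2 hD₂] at h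
      simpa using h
    exact Prod.ext (Finset.coe_injective e1) (Finset.coe_injective e2)
  -- every index set is in Y, above Z
  have hgY : ∀ t ∈ Pairs, g t ∈ cellY M p q ∧ Z ⊆ g t := by
    intro t ht
    obtain ⟨hP, hD, hpos, hlt⟩ := hmemPairs t ht
    have hsubE : g t ⊆ M.E := by
      simp only [hg]
      exact Set.union_subset (Set.union_subset hZ.1 (hP.trans (fun x hx => hx.1.1)))
        (hD.trans (fun x hx => hx.1.1))
    refine ⟨⟨hsubE, ?_, ?_⟩, ?_⟩
    · -- q < r(g t): pick d ∈ X_D, d ∉ cl Z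
      obtain ⟨d, hd⟩ := Finset.card_pos.1 hpos
      have hdD : d ∈ freePart M Z := hD (Finset.mem_coe.2 hd)
      have hdE : d ∈ M.E \ M.closure Z := ⟨hdD.1.1, hdD.2⟩
      have h1 : M.eRk (insert d Z) = M.eRk Z + 1 := M.eRk_insert_eq_add_one hdE
      have h2 : insert d Z ⊆ g t := by
        intro x hx
        rcases hx with rfl | hx
        · exact Or.inr (Finset.mem_coe.2 hd)
        · exact Or.inl (Or.inl hx)
      have h3 := M.eRk_mono h2
      rw [h1, hZ.2.1] at h3
      have h4 : (q : ℕ∞) < (q : ℕ∞) + 1 := by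
        have := Nat.lt_succ_self q
        exact_mod_cast this
      exact h4.trans_le h3
    · -- r(g t) < p: g t ⊆ cl Z ∪ X_D
      have hsub : g t ⊆ M.closure Z ∪ (↑t.2 : Set α) := by
        intro x hx
        rcases hx with (hx | hx) | hx
        · exact Or.inl (M.subset_closure Z hZ.1 hx)
        · exact Or.inl (hP hx).2
        · exact Or.inr hx
      have h1 := M.eRk_mono hsub
      have h2 := M.eRk_union_le_eRk_add_encard (M.closure Z) (↑t.2 : Set α)
      rw [M.eRk_closure_eq, hZ.2.1, encard_coe_eq_coe_finsetCard] at h2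
      calc M.eRk (g t) ≤ (q : ℕ∞) + (t.2.card : ℕ∞) := h1.trans h2
        _ < (p : ℕ∞) := by
          rw [hp]
          have : q + t.2.card < q + k := by omega
          exact_mod_cast this
    · exact fun x hx => Or.inl (Or.inl hx)
  -- the bound on each index set
  have hbound : ∀ t ∈ Pairs, (1 : ℚ) / (mhat q m t.1.card t.2.card : ℚ) ≤ 1 / (memCount M p q (g t) : ℚ) := by
    intro t ht
    obtain ⟨hP, hD, -, -⟩ := hmemPairs t ht
    have h1 := memCount_le_mhat M hE hZ hP hD
    rw [ncard_coe_finset, ncard_coe_finset, ← hm] at h1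
    have h2 := one_le_memCount_of_subset M hZ (hgY t ht).2
    have hpos : (0 : ℚ) < (memCount M p q (g t) : ℚ) := by exact_mod_cast h2
    exact one_div_le_one_div_of_le hpos (by exact_mod_cast h1)
  -- assembly
  set F : Set α → ℚ := Set.indicator {S : Set α | Z ⊆ S} (fun S => 1 / (memCount M p q S : ℚ)) with hF
  have hYsub : Pairs.image g ⊆ (cellY_finite M p q).toFinset := by
    intro S hS
    rw [Finset.mem_image] at hS
    obtain ⟨t, ht, rfl⟩ := hS
    rw [(cellY_finite M p q).mem_toFinset]
    exact (hgY t ht).1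
  have step1 : ∑ S ∈ Pairs.image g, F S ≤ ruleQRecv M p q Z := by
    unfold ruleQRecv
    refine Finset.sum_le_sum_of_subset_of_nonneg hYsub (fun S _ _ => ?_)
    exact Set.indicator_nonneg (fun S _ => by positivity) S
  have step2 : ∑ S ∈ Pairs.image g, F S = ∑ t ∈ Pairs, 1 / (memCount M p q (g t) : ℚ) := by
    rw [Finset.sum_image hginj]
    refine Finset.sum_congr rfl (fun t ht => ?_)
    rw [hF, Set.indicator_of_mem]
    exact (hgY t ht).2
  have step3 : ∑ t ∈ Pairs, (1 : ℚ) / (mhat q m t.1.card t.2.card : ℚ) ≤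
      ∑ t ∈ Pairs, 1 / (memCount M p q (g t) : ℚ) :=
    Finset.sum_le_sum hbound
  -- fiberwise by the sizes
  have hmaps : ∀ t ∈ Pairs, (t.1.card, t.2.card) ∈ Finset.range (m + 1) ×ˢ Finset.Ioo 0 k := by
    intro t ht
    rw [hPairs, Finset.mem_product, Finset.mem_powerset, Finset.mem_filter] at ht
    rw [Finset.mem_product, Finset.mem_range, Finset.mem_Ioo]
    have := Finset.card_le_card ht.1
    rw [hPcard] at this
    exact ⟨by omega, ht.2.2.1, ht.2.2.2⟩
  have step4 : ∑ t ∈ Pairs, (1 : ℚ) / (mhat q m t.1.card t.2.card : ℚ) =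
      ∑ aj ∈ Finset.range (m + 1) ×ˢ Finset.Ioo 0 k,
        ((m.choose aj.1 * (q + k - m).choose aj.2 : ℕ) : ℚ) / (mhat q m aj.1 aj.2 : ℚ) := by
    rw [← Finset.sum_fiberwise_of_maps_to' hmaps (fun aj => (1 : ℚ) / (mhat q m aj.1 aj.2 : ℚ))]
    refine Finset.sum_congr rfl (fun aj haj => ?_)
    rw [Finset.sum_const, nsmul_eq_mul]
    -- the fiber is Pf.powersetCard a ×ˢ Df.powersetCard j
    have hfib : Pairs.filter (fun t => (t.1.card, t.2.card) = aj) =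
        Pf.powersetCard aj.1 ×ˢ Df.powersetCard aj.2 := by
      rw [Finset.mem_product, Finset.mem_range, Finset.mem_Ioo] at haj
      ext t
      rw [Finset.mem_filter, hPairs, Finset.mem_product, Finset.mem_powerset, Finset.mem_filter,
        Finset.mem_powerset, Finset.mem_product, Finset.mem_powersetCard, Finset.mem_powersetCard,
        Prod.ext_iff]
      constructor
      · rintro ⟨⟨h1, h2, -, -⟩, h3, h4⟩
        exact ⟨⟨h1, h3⟩, ⟨h2, h4⟩⟩
      · rintro ⟨⟨h1, h3⟩, ⟨h2, h4⟩⟩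
        refine ⟨⟨h1, h2, ?_, ?_⟩, h3, h4⟩
        · rw [h4]; exact haj.2.1
        · rw [h4]; exact haj.2.2
    rw [hfib, Finset.card_product, Finset.card_powersetCard, Finset.card_powersetCard, hPcard, hDcard]
    push_cast
    ring
  have step5 : rhat q k m = ∑ aj ∈ Finset.range (m + 1) ×ˢ Finset.Ioo 0 k,
      ((m.choose aj.1 * (q + k - m).choose aj.2 : ℕ) : ℚ) / (mhat q m aj.1 aj.2 : ℚ) := by
    unfold rhat
    rw [Finset.sum_product]
    rw [Finset.sum_comm]
  calc rhat q k m = _ := step5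
    _ = ∑ t ∈ Pairs, (1 : ℚ) / (mhat q m t.1.card t.2.card : ℚ) := step4.symm
    _ ≤ ∑ t ∈ Pairs, 1 / (memCount M p q (g t) : ℚ) := step3
    _ = ∑ S ∈ Pairs.image g, F S := step2.symm
    _ ≤ ruleQRecv M p q Z := step1


/-- `#P ≤ q`: the flat part of a member's complement is an independent subset of `cl Z`. -/
lemma ncard_flatPart_le {p q : ℕ} (hE : M.E.ncard = p + q) {Z : Set α} (hZ : Z ∈ cellMembers M p q) :
    (flatPart M Z).ncard ≤ q := by
  obtain ⟨hind, -⟩ := compl_indep_of_mem_U M hE hZ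
  have hPind : M.Indep (flatPart M Z) := hind.subset (fun x hx => hx.1)
  have h1 : M.eRk (flatPart M Z) ≤ M.eRk (M.closure Z) := M.eRk_mono (fun x hx => hx.2)
  rw [M.eRk_closure_eq, hZ.2.1, hPind.eRk_eq_encard,
    ← (M.ground_finite.subset (fun x hx => hx.1.1)).cast_ncard_eq] at h1
  exact_mod_cast h1

/-- **Rule Q at the tight layer of every cell `(q + k, q)`, modulo (R̂)**: if the arithmetic inequality holds then every
member receives at least `Φ(q+k, q)`. -/
theorem ruleQUp_of_ncard_eq_of_rhat (hR : RhatIneq) {q k : ℕ} (hq : 1 ≤ q) (hk : 2 ≤ k)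
    (hE : M.E.ncard = (q + k) + q) : RuleQUp M (q + k) q := by
  intro Z hZ
  have h1 := hR q k (flatPart M Z).ncard hq hk (ncard_flatPart_le M hE hZ)
  exact h1.trans (rhat_le_ruleQRecv M hE hZ)

/-- **The UP form of C-044 at the tight layer of every cell, modulo (R̂)**: `#E = (q+k) + q`, `q ≥ 1`, `k ≥ 2` and
(R̂) ⇒ every family `𝒜` of members has at least `Φ(q+k,q)·#𝒜` UP-neighbours. -/
theorem hallUp_of_ncard_eq_of_rhat (hR : RhatIneq) {q k : ℕ} (hq : 1 ≤ q) (hk : 2 ≤ k)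
    (hE : M.E.ncard = (q + k) + q) (𝒜 : Set (Set α)) (h𝒜 : 𝒜 ⊆ cellMembers M (q + k) q) :
    phiK (q + k) q * (𝒜.ncard : ℚ) ≤ ((upNbhd M (q + k) q 𝒜).ncard : ℚ) :=
  hallUp_of_ruleQ M (q + k) q (ruleQUp_of_ncard_eq_of_rhat M hR hq hk hE) 𝒜 h𝒜

end PercRepro
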